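import Summits.QuantumFields.YangMills.Theorems.UnitScaleTiltProp7FrameResponseCombSU2T3
import Summits.QuantumFields.YangMills.Theorems.UnitScaleTiltProp7LegLemmaQTw
import Summits.QuantumFields.YangMills.Theorems.UnitScaleTiltProp7SigmaIdentityComb
import HarnessLib

/-!
# Route `UnitScaleTilt`, crux K1 «MinimiserStabilityRegPr» (stmt-QuantumFields-19200), route-R E′ architecture (A′)-on-Σ (★★OWNER RULINGS g28-№13 ∕ g29-№16) — **THE JOINT-Σ LEG
# DOOR** (★p1 g17 WORD 25 (a) «GO — yours, whole cell»): the JOINT conjunct of the Σ-rows door ✓`Prop7HcoSOfSigmaRows.hcoS_of_sigmaRowsS` from the P-A2 binder's `ℓ¹` bound on the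
# COMB chart remainder `Σ_ĉ ‖C(W, iX)(ĉ)‖`

Cell `ym3-torus`, D-0154 (3c) twin-width seat `ym-routeR-w2` (gen 8), 2026-08-29 (SIGN-IN offer 03:21Z §2–§3; FILE A = ✓`Prop7FrameResponseCombSU2` «F0-COMB»).
THEOREMS ONLY (0 `def`, 0 `sorry`); `--supports stmt-QuantumFields-19200 --as helper`, count-neutral.  YM₃ on T³ is a ladder rung (R3), not the Clay problem; nothing here claims
the stub, the crux, `hcoS`, E′, EX, d = 4 or the mass gap.

WHY (★p1 g17 E2E-SIGMA-SPEC row 8, WORDS 20–25).  The JOINT conjunct of the Σ-rows door reads, for the E′ recursion family `Q` and a Σ-representative `X`: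
`∀ Q (hQ0) (hQs), ∃ μ : Site (F.P K) (K−n) → M₂, (∀ y, μ y ∈ 𝔰𝔲(2)) ∧ Σ_{c : PBond (F.P K) (K−n)} ‖Q^{(K−n)}(iX)(c) − (μ(c₋) − W̄(c)μ(c₊)W̄(c)ᴴ)‖ ≤ C₁ℓ⁻¹M + C₂ℓ(K + dv)`.
The P-A1 LEG for the comb-framed chart (✓`Prop7LegLemmaQTw.QTw_apply_eq_trueLinIter_sub_coarseGauge_T3`) says that, bond by bond on the COMPARISON lattice `PBond (F.P n) 0`,
`QTw_W A ĉ = Q^{(K−n)} A (bondShift ĉ) − (r(ĉ₋)A − W̄·r(ĉ₊)A·W̄ᴴ)` with `r(y)A` the linearised comb frame; FILE A (✓`Prop7FrameResponseCombSU2.combFrameResponse_mem_skewAdjoint_trace_zero`)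
says `r(y)A ∈ 𝔰𝔲(2)` for `𝔰𝔲(2)`-valued `A`; and on Σ (`AvgCondPrint`, (20) with `B = 0`) ✓`Prop7SigmaIdentityComb.QTw_eq_neg_CmapTw_of_sigma` says `QTw_W(iX) = −C(W, iX)`.  This file
is the bookkeeping that puts the three together in the DOOR'S OWN LETTERS: the sum over `PBond (F.P K) (K−n)` is re-indexed along lit's `T3LevelShift.bondShift (sites_eq F n K h)` (an
`Equiv`; `Equiv.sum_comp`), the gauge function is `μ := r(·)A ∘ (siteShift (sites_eq F n K h)).symm`, and the seams `(bondShift ĉ).src∕.tgt = siteShift ĉ.src∕ĉ.tgt` are lit's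
`bondShift_src` (rfl) ∕ `bondShift_tgt`.  OUTPUT: the JOINT conjunct TOKEN FOR TOKEN — so the E2E feeds the P-A2 binder's output (comb route (β) of WORD 23, or any other) by `exact`,
and P-A2 suppliers target `Σ_ĉ ‖CmapTw F n K h W (fun b ↦ I•X b) ĉ‖` and nothing else.

WHAT IS PROVED (ns `…Theorems.Prop7JointSigmaOfCmapTwL1`; T³, `SU(2)`).
* §1 ★★ `exists_frameGauge_sum_norm_eq_sum_norm_QTw` — at `RegPr F n K ε₀ W` (`10¹⁰L⁶ε₀ ≤ 1`), for the E′ family `Q hQ0 hQs` and every bondwise skew-adjoint traceless `A`: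
  `∃ μ, (∀ y, μ y ∈ skewAdjoint ∧ tr = 0) ∧ Σ_{c : PBond (F.P K) (K−n)} ‖Q (K−n) A c − G_c(μ)‖ = Σ_{ĉ : PBond (F.P n) 0} ‖QTw F n K h W A ĉ‖` (chart point; no Σ needed).
* §2 ★★★ `jointSigma_of_l1_CmapTw` — on the `hcoS` binder (`W ∈ regFibrePr F n K h e V`, `In19 F n K ε₂ W (expHermField X) X`, `AvgCondPrint F n K h V W X`; the windows of
  ✓`QTw_eq_neg_CmapTw_of_sigma` VERBATIM plus `10¹⁰L⁶e ≤ 1`) and ANY `hB : Σ_ĉ ‖CmapTw F n K h W (fun b ↦ I•X b) ĉ‖ ≤ B`: the JOINT conjunct (`∀ Q hQ0 hQs, ∃ μ …`) with right side `B`.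
* §3 ★★★ `jointRow_of_l1_CmapTw` — ★p1 g17 WORD 25 (a)'s TARGET: `hbind : Σ_ĉ ‖CmapTw …‖ ≤ C₁ℓ⁻¹M + C₂ℓ(K + dv)` ⊢ THE JOINT CONJUNCT of ✓`hcoS_of_sigmaRowsS` TOKEN FOR TOKEN
  (§2 at that `B`, by `exact`).
HONEST SCOPE.  Re-indexing + composition of landed theorems; no estimate; nothing of print asserted; JOINT∕P-A2∕`hcoS` are NOT closed by this file (the bound is an INPUT).

References: T. Bałaban, CMP 102 (1985) 277–309 [Balaban1985Variational] ((19)–(20) p.281, (44)–(48) p.285, (47) p.286, (106)–(111) p.294, (141)–(142) p.299); CMP 98 (1985) 17–51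
[Balaban1985Averaging] ((89)–(92) p.31, (97) p.32, (125)–(127) p.36); CMP 99 (1985) 389–434 [Balaban1985BackgroundPropagators] ((3.14)–(3.15) p.393); CMP 109 (1987) 249–301
[Balaban1987RG1] ((0.1) p.251, (0.11) p.253).
-/

set_option autoImplicit false

noncomputable section

open scoped BigOperators Matrix.Norms.L2Operator Matrix Topology

namespace Summit.QuantumFields.YangMills.Theorems.Prop7JointSigmaOfCmapTwL1

open Literature.MathematicalPhysics.QuantumFieldTheory.Balaban1983to89
open Literature.MathematicalPhysics.QuantumFieldTheory.Balaban1983to89.T3ContinuumYM3Torus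
open T4Continuum BlockAveraging AveragingRT ExpMeanLog BlockAveragingEMLLinearised BlockAveragingEMLLinearisedBackground BlockAveragingEMLProp2
open T3PrintedRegularMinimiser (RegPr regFibrePr mem_regFibrePr_iff)
open T3LevelShift (bondShift siteShift bondShift_tgt)
open T3PrintedRegularOrbits (sites_eq)
open T3SectALandauChart (In19 eta)
open B7Prop2Explicit (C0 c2')
open B7Prop3Flat (c3)
open Summit.QuantumFields.YangMills.Theorems.Prop7TPrint (expHermField)
open Summit.QuantumFields.YangMills.Theorems.Prop7SPrint (AvgCondPrint)
open Summit.QuantumFields.YangMills.Theorems.Prop7SymAvgTw (frameTw QTw CmapTw)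
open Summit.QuantumFields.YangMills.Theorems.Prop7LegLemmaQTw (QTw_apply_eq_trueLinIter_sub_coarseGauge_T3)
open Summit.QuantumFields.YangMills.Theorems.Prop7FrameResponseCombSU2 (combFrameResponse_mem_skewAdjoint_trace_zero)
open Summit.QuantumFields.YangMills.Theorems.Prop7SigmaIdentityComb (QTw_eq_neg_CmapTw_of_sigma)

variable (F : T3Family) {n K : ℕ} (h : n ≤ K)

/-! ## §1 The JOINT sum modulo the linearised comb frames IS the `ℓ¹` norm of `QTw` on the comparison lattice -/

/-- ★★ **THE JOINT SUM MODULO THE COMB FRAME GAUGE EQUALS `Σ_ĉ ‖QTw_W A ĉ‖`, WITH AN `𝔰𝔲(2)`-VALUED GAUGE FUNCTION**: at a printed-regular `W` (`RegPr F n K ε₀ W`,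
`10¹⁰L⁶ε₀ ≤ 1`), for the E′ recursion family `Q` and every bondwise skew-adjoint traceless `A`, the coarse gauge function `μ := r(·)A ∘ (siteShift (sites_eq F n K h)).symm`
(`r(y)A = fderiv ℂ (A ↦ ↑(frameTw W A y)) 0 A`, ✓FILE A: `𝔰𝔲(2)`-valued) satisfies
`Σ_{c : PBond (F.P K) (K−n)} ‖Q (K−n) A c − (μ c.src − W̄(c)·μ c.tgt·W̄(c)ᴴ)‖ = Σ_{ĉ : PBond (F.P n) 0} ‖QTw F n K h W A ĉ‖` — ✓LEG-COMB-T³ bond by bond after re-indexing along the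
`Equiv` `bondShift (sites_eq F n K h)` (seams `bondShift_src` (rfl), `bondShift_tgt`).
[cite: Balaban1985Averaging, (125)-(127) p.36, (89)-(92) p.31, (97) p.32; Balaban1985Variational, (44)-(48) p.285; Balaban1987RG1, (0.1) p.251, (0.11) p.253] -/
theorem exists_frameGauge_sum_norm_eq_sum_norm_QTw {ε₀ : ℝ} (hε₀ : 0 < ε₀) (hε : 10 ^ 10 * (F.L : ℝ) ^ 6 * ε₀ ≤ 1)
    (W : GaugeField (F.P K) 0 (Matrix.specialUnitaryGroup (Fin 2) ℂ)) (hreg : RegPr F n K ε₀ W)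
    (Q : (k : ℕ) → (PBond (F.P K) 0 → Matrix (Fin 2) (Fin 2) ℂ) → PBond (F.P K) k → Matrix (Fin 2) (Fin 2) ℂ) (hQ0 : ∀ Y, Q 0 Y = Y)
    (hQs : ∀ (k : ℕ) (Y : PBond (F.P K) 0 → Matrix (Fin 2) (Fin 2) ℂ) (c : PBond (F.P K) (k + 1)), Q (k + 1) Y c
      = fderiv ℂ (eml : (Idx (F.P K) → Matrix (Fin 2) (Fin 2) ℂ) → Matrix (Fin 2) (Fin 2) ℂ)
            (fun i => ((loopHol (Averaging.iter (fun i => blockAvg (P := F.P K) (j := i) (expMeanLogSU (n := Fin 2))) k W) c i :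
              Matrix.specialUnitaryGroup (Fin 2) ℂ) : Matrix (Fin 2) (Fin 2) ℂ))
            (fun i => covWalkSum (Averaging.iter (fun i => blockAvg (P := F.P K) (j := i) (expMeanLogSU (n := Fin 2))) k W) (Q k Y)
                (walk (emb c.src) (loopWord (F.P K).L c.dir (off i.1) i.2.1 i.2.2))
              * ((loopHol (Averaging.iter (fun i => blockAvg (P := F.P K) (j := i) (expMeanLogSU (n := Fin 2))) k W) c i :
                Matrix.specialUnitaryGroup (Fin 2) ℂ) : Matrix (Fin 2) (Fin 2) ℂ))
            * star ((corr (expMeanLogSU (n := Fin 2)) (Averaging.iter (fun i => blockAvg (P := F.P K) (j := i) (expMeanLogSU (n := Fin 2))) k W) c :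
                Matrix.specialUnitaryGroup (Fin 2) ℂ) : Matrix (Fin 2) (Fin 2) ℂ)
          + ((corr (expMeanLogSU (n := Fin 2)) (Averaging.iter (fun i => blockAvg (P := F.P K) (j := i) (expMeanLogSU (n := Fin 2))) k W) c :
                Matrix.specialUnitaryGroup (Fin 2) ℂ) : Matrix (Fin 2) (Fin 2) ℂ)
            * covWalkSum (Averaging.iter (fun i => blockAvg (P := F.P K) (j := i) (expMeanLogSU (n := Fin 2))) k W) (Q k Y)
                (walk (emb c.src) (List.replicate (F.P K).L (c.dir, true)))
            * star ((corr (expMeanLogSU (n := Fin 2)) (Averaging.iter (fun i => blockAvg (P := F.P K) (j := i) (expMeanLogSU (n := Fin 2))) k W) c :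
                Matrix.specialUnitaryGroup (Fin 2) ℂ) : Matrix (Fin 2) (Fin 2) ℂ))
    (A : PBond (F.P K) 0 → Matrix (Fin 2) (Fin 2) ℂ) (hA : ∀ b, A b ∈ skewAdjoint (Matrix (Fin 2) (Fin 2) ℂ)) (htr : ∀ b, (A b).trace = 0) :
    ∃ μ : Site (F.P K) (K - n) → Matrix (Fin 2) (Fin 2) ℂ, (∀ y, μ y ∈ skewAdjoint (Matrix (Fin 2) (Fin 2) ℂ) ∧ (μ y).trace = 0) ∧
      ∑ c : PBond (F.P K) (K - n), ‖Q (K - n) A c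
          - (μ c.src
            - ((Averaging.iter (fun i => blockAvg (P := F.P K) (j := i) (expMeanLogSU (n := Fin 2))) (K - n) W c : Matrix.specialUnitaryGroup (Fin 2) ℂ) :
                Matrix (Fin 2) (Fin 2) ℂ) * μ c.tgt
              * star ((Averaging.iter (fun i => blockAvg (P := F.P K) (j := i) (expMeanLogSU (n := Fin 2))) (K - n) W c : Matrix.specialUnitaryGroup (Fin 2) ℂ) :
                Matrix (Fin 2) (Fin 2) ℂ))‖
        = ∑ ĉ : PBond (F.P n) 0, ‖QTw F n K h W A ĉ‖ := by
  -- windows for FILE A (`10⁷L³ε₀ ≤ 1` from `10¹⁰L⁶ε₀ ≤ 1`)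
  have hL3 : (3 : ℝ) ≤ (F.L : ℝ) := by
    have h3 : 3 ≤ F.L := by obtain ⟨a, ha⟩ := F.hL.1; have := F.hL.2; omega
    exact_mod_cast h3
  have hL1 : (1 : ℝ) ≤ (F.L : ℝ) := by linarith
  have hε7 : 10 ^ 7 * (F.L : ℝ) ^ 3 * ε₀ ≤ 1 := by
    have h36 : (F.L : ℝ) ^ 3 ≤ (F.L : ℝ) ^ 6 := pow_le_pow_right₀ hL1 (by norm_num)
    nlinarith [h36, hε₀.le, pow_nonneg (zero_le_one.trans hL1) 3]
  -- the level identifications, typed on `F.P` (so that every term below is type-correct at `instances` transparency), and the gauge function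
  let σ : Site (F.P n) 0 ≃ Site (F.P K) (K - n) := siteShift (sites_eq F n K h)
  let e : PBond (F.P n) 0 ≃ PBond (F.P K) (K - n) := bondShift (sites_eq F n K h)
  refine ⟨fun y => fderiv ℂ (fun A' : PBond (F.P K) 0 → Matrix (Fin 2) (Fin 2) ℂ =>
      ((frameTw F n K h W A' (σ.symm y) : (Matrix (Fin 2) (Fin 2) ℂ)ˣ) : Matrix (Fin 2) (Fin 2) ℂ)) 0 A,
    fun y => combFrameResponse_mem_skewAdjoint_trace_zero F h hε₀ hε7 W hreg hA htr _, ?_⟩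
  -- re-index the JOINT sum along `e : PBond (F.P n) 0 ≃ PBond (F.P K) (K − n)` and rewrite each summand by the LEG
  refine (Fintype.sum_equiv e _ _ fun ĉ => ?_).symm
  have hs : σ.symm (e ĉ).src = ĉ.src := Equiv.symm_apply_apply σ ĉ.src
  have ht : σ.symm (e ĉ).tgt = ĉ.tgt := by
    have h1 : (e ĉ).tgt = σ ĉ.tgt := bondShift_tgt _ _
    rw [h1]
    exact Equiv.symm_apply_apply σ ĉ.tgt
  simp only [hs, ht]
  rw [QTw_apply_eq_trueLinIter_sub_coarseGauge_T3 F h hε₀ hε W hreg Q hQ0 hQs A hA htr ĉ]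
  rfl

/-! ## §2 ★★★ On Σ: the JOINT conjunct of the Σ-rows door from any `ℓ¹` bound on the comb chart remainder -/

/-- ★★★ **THE JOINT-Σ LEG DOOR (generic right side).**  On the binder of the growth socket `hcoS` — `W ∈ (6)(e) ∩ 𝔅_k(V)` (`regFibrePr`), (19) `In19 F n K ε₂ W (expHermField X) X`,
(20) `AvgCondPrint F n K h V W X` — inside the windows of ✓`QTw_eq_neg_CmapTw_of_sigma` VERBATIM plus `10¹⁰L⁶e ≤ 1`, EVERY bound `Σ_ĉ ‖C(W, iX)(ĉ)‖ ≤ B` on the comb chart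
remainder over the comparison bonds yields the JOINT conjunct of ✓`Prop7HcoSOfSigmaRows.hcoS_of_sigmaRowsS` with right side `B`: for every E′ recursion family `Q`,
`∃ μ (𝔰𝔲(2)-valued), Σ_{c : PBond (F.P K) (K−n)} ‖Q (K−n) (iX) c − (μ c.src − W̄(c)·μ c.tgt·W̄(c)ᴴ)‖ ≤ B` — §1 at `A := iX` (skew-adjoint traceless by (19)), then `QTw_W(iX) = −C(W, iX)`
on Σ and `‖−z‖ = ‖z‖`.
[cite: Balaban1985Variational, (19)-(20) p.281, (44) p.285, (141)-(142) p.299; Balaban1985Averaging, (125)-(127) p.36; Balaban1985BackgroundPropagators, (3.14)-(3.15) p.393] -/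
theorem jointSigma_of_l1_CmapTw {e ε₂ : ℝ} (he : 0 < e) (hε₂ : 0 < ε₂) (heε : e ≤ ε₂) (hε₂4 : ε₂ ≤ 1 / 4)
    (he10 : 10 ^ 10 * (F.L : ℝ) ^ 6 * e ≤ 1) (h178 : 10 ^ 7 * (F.L : ℝ) ^ 3 * (178 * ε₂) ≤ 1) (he6 : 10 ^ 6 * (F.L : ℝ) ^ 2 * ε₂ ≤ 1)
    (hα3 : C0 (F.P K).d * (2 * e) ≤ 1 / 3) (hα4 : 4 * (2 * e) ≤ c2' (F.P K).d (F.P K).L)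
    (hsmall : Real.exp (4 * (800 * (((F.P K).d : ℝ) + 1) ^ 2 * (((F.P K).d : ℝ) + 4)) * (2 * e))
      * (1 + 8 * (131072 * (((F.P K).d : ℝ) + 1) ^ 2) * ε₂) ≤ 2)
    (hc₃ : 2 * ε₂ ≤ c3 (F.P K).d (F.P K).L) (hsm : 2048 * ((F.P K).d : ℝ) * ε₂ ≤ 1)
    {V : GaugeField (F.P n) 0 (Matrix.specialUnitaryGroup (Fin 2) ℂ)} {W : GaugeField (F.P K) 0 (Matrix.specialUnitaryGroup (Fin 2) ℂ)}
    (hW : W ∈ regFibrePr F n K h e V) {X : PBond (F.P K) 0 → Matrix (Fin 2) (Fin 2) ℂ}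
    (h19 : In19 F n K ε₂ W (expHermField X) X) (h20 : AvgCondPrint F n K h V W X)
    {B : ℝ} (hB : ∑ ĉ : PBond (F.P n) 0, ‖CmapTw F n K h W (fun b => Complex.I • X b) ĉ‖ ≤ B) :
    ∀ (Q : (k : ℕ) → (PBond (F.P K) 0 → Matrix (Fin 2) (Fin 2) ℂ) → PBond (F.P K) k → Matrix (Fin 2) (Fin 2) ℂ), (∀ Y, Q 0 Y = Y) →
        (∀ (k : ℕ) (Y : PBond (F.P K) 0 → Matrix (Fin 2) (Fin 2) ℂ) (c : PBond (F.P K) (k + 1)), Q (k + 1) Y c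
          = fderiv ℂ (eml : (Idx (F.P K) → Matrix (Fin 2) (Fin 2) ℂ) → Matrix (Fin 2) (Fin 2) ℂ)
              (fun i => ((loopHol (Averaging.iter (fun i => blockAvg (P := F.P K) (j := i) (expMeanLogSU (n := Fin 2))) k W) c i :
                Matrix.specialUnitaryGroup (Fin 2) ℂ) : Matrix (Fin 2) (Fin 2) ℂ))
              (fun i => covWalkSum (Averaging.iter (fun i => blockAvg (P := F.P K) (j := i) (expMeanLogSU (n := Fin 2))) k W) (Q k Y)
                  (walk (emb c.src) (loopWord (F.P K).L c.dir (off i.1) i.2.1 i.2.2))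
                * ((loopHol (Averaging.iter (fun i => blockAvg (P := F.P K) (j := i) (expMeanLogSU (n := Fin 2))) k W) c i :
                  Matrix.specialUnitaryGroup (Fin 2) ℂ) : Matrix (Fin 2) (Fin 2) ℂ))
              * star ((corr (expMeanLogSU (n := Fin 2)) (Averaging.iter (fun i => blockAvg (P := F.P K) (j := i) (expMeanLogSU (n := Fin 2))) k W) c :
                  Matrix.specialUnitaryGroup (Fin 2) ℂ) : Matrix (Fin 2) (Fin 2) ℂ)
            + ((corr (expMeanLogSU (n := Fin 2)) (Averaging.iter (fun i => blockAvg (P := F.P K) (j := i) (expMeanLogSU (n := Fin 2))) k W) c :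
                  Matrix.specialUnitaryGroup (Fin 2) ℂ) : Matrix (Fin 2) (Fin 2) ℂ)
              * covWalkSum (Averaging.iter (fun i => blockAvg (P := F.P K) (j := i) (expMeanLogSU (n := Fin 2))) k W) (Q k Y)
                  (walk (emb c.src) (List.replicate (F.P K).L (c.dir, true)))
              * star ((corr (expMeanLogSU (n := Fin 2)) (Averaging.iter (fun i => blockAvg (P := F.P K) (j := i) (expMeanLogSU (n := Fin 2))) k W) c :
                  Matrix.specialUnitaryGroup (Fin 2) ℂ) : Matrix (Fin 2) (Fin 2) ℂ)) →
            ∃ μ : Site (F.P K) (K - n) → Matrix (Fin 2) (Fin 2) ℂ, (∀ y, μ y ∈ skewAdjoint (Matrix (Fin 2) (Fin 2) ℂ) ∧ (μ y).trace = 0) ∧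
            ∑ c : PBond (F.P K) (K - n), ‖Q (K - n) (fun b => Complex.I • X b) c
                - (μ c.src
                  - ((Averaging.iter (fun i => blockAvg (P := F.P K) (j := i) (expMeanLogSU (n := Fin 2))) (K - n) W c : Matrix.specialUnitaryGroup (Fin 2) ℂ) :
                      Matrix (Fin 2) (Fin 2) ℂ) * μ c.tgt
                    * star ((Averaging.iter (fun i => blockAvg (P := F.P K) (j := i) (expMeanLogSU (n := Fin 2))) (K - n) W c : Matrix.specialUnitaryGroup (Fin 2) ℂ) :
                      Matrix (Fin 2) (Fin 2) ℂ))‖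
              ≤ B := by
  intro Q hQ0 hQs
  -- the representative is printed-regular and `iX` is `𝔰𝔲(2)`-valued ((6), (19))
  have hreg : RegPr F n K e W := ((mem_regFibrePr_iff F).1 hW).2
  have hA : ∀ b, (fun b => Complex.I • X b) b ∈ skewAdjoint (Matrix (Fin 2) (Fin 2) ℂ) := fun b => by
    have hH := (h19.1 b).1
    refine skewAdjoint.mem_iff.2 ?_
    show star (Complex.I • X b) = -(Complex.I • X b)
    rw [star_smul, Complex.star_def, Complex.conj_I, Matrix.star_eq_conjTranspose, hH.eq, neg_smul]
  have htr : ∀ b, ((fun b => Complex.I • X b) b).trace = 0 := fun b => by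
    show (Complex.I • X b).trace = 0
    rw [Matrix.trace_smul, (h19.1 b).2, smul_zero]
  -- FILE A's window `10⁷L³e ≤ 1` for the Σ-identity (it is also inside `10¹⁰L⁶e ≤ 1`)
  have hε7 : 10 ^ 7 * (F.L : ℝ) ^ 3 * e ≤ 1 := by
    have hL1 : (1 : ℝ) ≤ (F.L : ℝ) := by exact_mod_cast (le_trans (by norm_num) F.hL.2.le)
    have h36 : (F.L : ℝ) ^ 3 ≤ (F.L : ℝ) ^ 6 := pow_le_pow_right₀ hL1 (by norm_num)
    nlinarith [h36, he.le, pow_nonneg (zero_le_one.trans hL1) 3]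
  -- §1 at `A := iX`
  obtain ⟨μ, hμ, hsum⟩ := exists_frameGauge_sum_norm_eq_sum_norm_QTw F h he he10 W hreg Q hQ0 hQs (fun b => Complex.I • X b) hA htr
  refine ⟨μ, hμ, ?_⟩
  rw [hsum, QTw_eq_neg_CmapTw_of_sigma F h he hε₂ heε hε₂4 hε7 h178 he6 hα3 hα4 hsmall hc₃ hsm hW h19 h20]
  simpa only [Pi.neg_apply, norm_neg] using hB

/-! ## §3 ★★★ The namer's target: the JOINT conjunct VERBATIM from the P-A2 binder -/

/-- ★★★ **THE JOINT-Σ LEG DOOR IN THE E2E'S CURRENCY** (★p1 g17 WORD 25 (a)'s target `jointRow_of_l1_CmapTw`): on the `hcoS` binder, the P-A2 binder's output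
`Σ_ĉ ‖CmapTw F n K h W (fun b ↦ I•X b) ĉ‖ ≤ C₁·ℓ⁻¹·Σ_b‖X b‖² + C₂·ℓ·(Σ_p‖ℒ_p(X)‖² + dv)` gives THE JOINT CONJUNCT of ✓`Prop7HcoSOfSigmaRows.hcoS_of_sigmaRowsS` TOKEN FOR TOKEN
(`∀ Q hQ0 hQs, ∃ μ …`); §2 at that right side.
[cite: Balaban1985Variational, (19)-(20) p.281, (44) p.285, (47) p.286, (106)-(111) p.294, (141)-(142) p.299; Balaban1985Averaging, (125)-(127) p.36] -/
theorem jointRow_of_l1_CmapTw {e ε₂ : ℝ} (he : 0 < e) (hε₂ : 0 < ε₂) (heε : e ≤ ε₂) (hε₂4 : ε₂ ≤ 1 / 4)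
    (he10 : 10 ^ 10 * (F.L : ℝ) ^ 6 * e ≤ 1) (h178 : 10 ^ 7 * (F.L : ℝ) ^ 3 * (178 * ε₂) ≤ 1) (he6 : 10 ^ 6 * (F.L : ℝ) ^ 2 * ε₂ ≤ 1)
    (hα3 : C0 (F.P K).d * (2 * e) ≤ 1 / 3) (hα4 : 4 * (2 * e) ≤ c2' (F.P K).d (F.P K).L)
    (hsmall : Real.exp (4 * (800 * (((F.P K).d : ℝ) + 1) ^ 2 * (((F.P K).d : ℝ) + 4)) * (2 * e))
      * (1 + 8 * (131072 * (((F.P K).d : ℝ) + 1) ^ 2) * ε₂) ≤ 2)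
    (hc₃ : 2 * ε₂ ≤ c3 (F.P K).d (F.P K).L) (hsm : 2048 * ((F.P K).d : ℝ) * ε₂ ≤ 1)
    {V : GaugeField (F.P n) 0 (Matrix.specialUnitaryGroup (Fin 2) ℂ)} {W : GaugeField (F.P K) 0 (Matrix.specialUnitaryGroup (Fin 2) ℂ)}
    (hW : W ∈ regFibrePr F n K h e V) {X : PBond (F.P K) 0 → Matrix (Fin 2) (Fin 2) ℂ}
    (h19 : In19 F n K ε₂ W (expHermField X) X) (h20 : AvgCondPrint F n K h V W X)
    {C₁ C₂ dv : ℝ} (hbind : ∑ ĉ : PBond (F.P n) 0, ‖CmapTw F n K h W (fun b => Complex.I • X b) ĉ‖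
      ≤ C₁ * ((F.L : ℝ) ^ (K - n))⁻¹ * (∑ b : PBond (F.P K) 0, ‖X b‖ ^ 2)
                + C₂ * (F.L : ℝ) ^ (K - n) * (∑ p : Plaq (F.P K) 0, ‖((Complex.I • X ⟨p.src, p.μ⟩) + ((W ⟨p.src, p.μ⟩ : Matrix (Fin 2) (Fin 2) ℂ) * (Complex.I • X ⟨p.src.shift p.μ, p.ν⟩) * star (W ⟨p.src, p.μ⟩ : Matrix (Fin 2) (Fin 2) ℂ))
            - (((W ⟨p.src, p.μ⟩ * W ⟨p.src.shift p.μ, p.ν⟩ * (W ⟨p.src.shift p.ν, p.μ⟩)⁻¹ : Matrix.specialUnitaryGroup (Fin 2) ℂ) : Matrix (Fin 2) (Fin 2) ℂ) * (Complex.I • X ⟨p.src.shift p.ν, p.μ⟩) * star ((W ⟨p.src, p.μ⟩ * W ⟨p.src.shift p.μ, p.ν⟩ * (W ⟨p.src.shift p.ν, p.μ⟩)⁻¹ : Matrix.specialUnitaryGroup (Fin 2) ℂ) : Matrix (Fin 2) (Fin 2) ℂ))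
            - (((GaugeField.plaqHol W p : Matrix.specialUnitaryGroup (Fin 2) ℂ) : Matrix (Fin 2) (Fin 2) ℂ) * (Complex.I • X ⟨p.src, p.ν⟩) * star ((GaugeField.plaqHol W p : Matrix.specialUnitaryGroup (Fin 2) ℂ) : Matrix (Fin 2) (Fin 2) ℂ)))‖ ^ 2 + dv)) :
    ∀ (Q : (k : ℕ) → (PBond (F.P K) 0 → Matrix (Fin 2) (Fin 2) ℂ) → PBond (F.P K) k → Matrix (Fin 2) (Fin 2) ℂ), (∀ Y, Q 0 Y = Y) →
        (∀ (k : ℕ) (Y : PBond (F.P K) 0 → Matrix (Fin 2) (Fin 2) ℂ) (c : PBond (F.P K) (k + 1)), Q (k + 1) Y c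
          = fderiv ℂ (eml : (Idx (F.P K) → Matrix (Fin 2) (Fin 2) ℂ) → Matrix (Fin 2) (Fin 2) ℂ)
              (fun i => ((loopHol (Averaging.iter (fun i => blockAvg (P := F.P K) (j := i) (expMeanLogSU (n := Fin 2))) k W) c i :
                Matrix.specialUnitaryGroup (Fin 2) ℂ) : Matrix (Fin 2) (Fin 2) ℂ))
              (fun i => covWalkSum (Averaging.iter (fun i => blockAvg (P := F.P K) (j := i) (expMeanLogSU (n := Fin 2))) k W) (Q k Y)
                  (walk (emb c.src) (loopWord (F.P K).L c.dir (off i.1) i.2.1 i.2.2))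
                * ((loopHol (Averaging.iter (fun i => blockAvg (P := F.P K) (j := i) (expMeanLogSU (n := Fin 2))) k W) c i :
                  Matrix.specialUnitaryGroup (Fin 2) ℂ) : Matrix (Fin 2) (Fin 2) ℂ))
              * star ((corr (expMeanLogSU (n := Fin 2)) (Averaging.iter (fun i => blockAvg (P := F.P K) (j := i) (expMeanLogSU (n := Fin 2))) k W) c :
                  Matrix.specialUnitaryGroup (Fin 2) ℂ) : Matrix (Fin 2) (Fin 2) ℂ)
            + ((corr (expMeanLogSU (n := Fin 2)) (Averaging.iter (fun i => blockAvg (P := F.P K) (j := i) (expMeanLogSU (n := Fin 2))) k W) c :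
                  Matrix.specialUnitaryGroup (Fin 2) ℂ) : Matrix (Fin 2) (Fin 2) ℂ)
              * covWalkSum (Averaging.iter (fun i => blockAvg (P := F.P K) (j := i) (expMeanLogSU (n := Fin 2))) k W) (Q k Y)
                  (walk (emb c.src) (List.replicate (F.P K).L (c.dir, true)))
              * star ((corr (expMeanLogSU (n := Fin 2)) (Averaging.iter (fun i => blockAvg (P := F.P K) (j := i) (expMeanLogSU (n := Fin 2))) k W) c :
                  Matrix.specialUnitaryGroup (Fin 2) ℂ) : Matrix (Fin 2) (Fin 2) ℂ)) →
            ∃ μ : Site (F.P K) (K - n) → Matrix (Fin 2) (Fin 2) ℂ, (∀ y, μ y ∈ skewAdjoint (Matrix (Fin 2) (Fin 2) ℂ) ∧ (μ y).trace = 0) ∧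
            ∑ c : PBond (F.P K) (K - n), ‖Q (K - n) (fun b => Complex.I • X b) c
                - (μ c.src
                  - ((Averaging.iter (fun i => blockAvg (P := F.P K) (j := i) (expMeanLogSU (n := Fin 2))) (K - n) W c : Matrix.specialUnitaryGroup (Fin 2) ℂ) :
                      Matrix (Fin 2) (Fin 2) ℂ) * μ c.tgt
                    * star ((Averaging.iter (fun i => blockAvg (P := F.P K) (j := i) (expMeanLogSU (n := Fin 2))) (K - n) W c : Matrix.specialUnitaryGroup (Fin 2) ℂ) :
                      Matrix (Fin 2) (Fin 2) ℂ))‖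
              ≤ C₁ * ((F.L : ℝ) ^ (K - n))⁻¹ * (∑ b : PBond (F.P K) 0, ‖X b‖ ^ 2)
                + C₂ * (F.L : ℝ) ^ (K - n) * (∑ p : Plaq (F.P K) 0, ‖((Complex.I • X ⟨p.src, p.μ⟩) + ((W ⟨p.src, p.μ⟩ : Matrix (Fin 2) (Fin 2) ℂ) * (Complex.I • X ⟨p.src.shift p.μ, p.ν⟩) * star (W ⟨p.src, p.μ⟩ : Matrix (Fin 2) (Fin 2) ℂ))
            - (((W ⟨p.src, p.μ⟩ * W ⟨p.src.shift p.μ, p.ν⟩ * (W ⟨p.src.shift p.ν, p.μ⟩)⁻¹ : Matrix.specialUnitaryGroup (Fin 2) ℂ) : Matrix (Fin 2) (Fin 2) ℂ) * (Complex.I • X ⟨p.src.shift p.ν, p.μ⟩) * star ((W ⟨p.src, p.μ⟩ * W ⟨p.src.shift p.μ, p.ν⟩ * (W ⟨p.src.shift p.ν, p.μ⟩)⁻¹ : Matrix.specialUnitaryGroup (Fin 2) ℂ) : Matrix (Fin 2) (Fin 2) ℂ))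
            - (((GaugeField.plaqHol W p : Matrix.specialUnitaryGroup (Fin 2) ℂ) : Matrix (Fin 2) (Fin 2) ℂ) * (Complex.I • X ⟨p.src, p.ν⟩) * star ((GaugeField.plaqHol W p : Matrix.specialUnitaryGroup (Fin 2) ℂ) : Matrix (Fin 2) (Fin 2) ℂ)))‖ ^ 2 + dv) :=
  jointSigma_of_l1_CmapTw F h he hε₂ heε hε₂4 he10 h178 he6 hα3 hα4 hsmall hc₃ hsm hW h19 h20 hbind

end Summit.QuantumFields.YangMills.Theorems.Prop7JointSigmaOfCmapTwL1

end
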